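import Summits.ABC.ABC.Theorems.TwistAmplificationSharpModerateLawCuspDispersionTwDefs
import Summits.ABC.ABC.Theorems.TwistAmplificationSharpModerateLawCuspLawDTransfer
import Summits.ABC.ABC.Theorems.TwistAmplificationSharpModerateLawCuspSumBoundNamed
import Summits.ABC.ABC.Theorems.TwistAmplificationSharpModerateLawCuspSumBound23
import Summits.ABC.ABC.Theorems.TwistAmplificationSharpModerateLawResolvedReduction

/-!
# Line `deep-moduli-cusp-dispersion` — crux `TwistAmplification.SharpModerateLaw` (stmt-ABC-1975): skeleton v8 (lead c2)

Lead `prover-line-stmt-ABC-1975-c2-0` (continuation of lead c1), 2026-08-16.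

v8 (cycle 2, 17:00Z; stubs unchanged from v7): the two THICK stubs 3–4 now have ONE conductor-free named core,
`ThickMissingTw` (`…CuspDispersionThickDefs.lean` p112944), provably EQUIVALENT up to `X^ε` to `LawOn ThickTw` = (stub 3 ∧ stub 4)'s
conclusions (`lawOn_thickTw_of_thickMissing`, `thickMissingTw_of_lawOn_thickTw`, `…ThickReduction.lean` p113665); and the summit
calibration is composed: `abc_of_lawOn_deepRegimeTw : LawOn DeepRegimeTw → ABC` (`…AbcOfDeepRegimeLawSummit.lean` p114185).
Final shape of the line: transfer + stationary phase LANDED; open = `ThickMissingTw` (⇒ ABC, ⇒ MazurKaneLaw) and `HallRegimeLawTw`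
(⇒ √-Hall near-miss count). Lead verdict: promote-stub on `stub_deepRegime` (= the summit in cusp coordinates).

v7 (cycle 2, 16:00Z): STUB 2′ `stub_cuspStationaryPhase23` has LANDED (`CuspDispersion.stub_cuspStationaryPhase23`,
`…CuspSumBound23.lean`, p106637; p = 3 half `…CuspSumBound23Lemmas.lean`) — three `sorry`s remain (stubs 3, 4, 5, all XL/open);
the resolved reduction `lawOn_resolvedRegimeTw_of_missing : ResolvedMissingTw → LawOn ResolvedRegimeTw` has LANDED
(`…ResolvedReduction.lean`, p106900); and the SUMMIT CALIBRATION of the hardest stub has landed in three pieces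
(`twistedFreyPair_inj` p105737, `twistedFreyPair_facts` p106445, `abc_of_lawOn_deepRegimeTw_of_facts` p112201 + lemmas p106502):
`LawOn DeepRegimeTw → ABC` — the conclusion of `stub_deepRegime` alone implies the summit (composition file
`…AbcOfDeepRegimeLawSummit.lean`).  v6 = c1's v5 (published 12:17Z) with the composition
`SharpModerateLaw_of` restated over exactly the four OPEN stubs (the landed stubs 1–2 enter as tree terms), so that the
skeleton registers (`skeleton.extra-hypothesis` on v5); `cuspSumBound23_three_main` (the `p = 3` half of STUB 2′) has
landed (`…CuspSumBound23Lemmas.lean`).  c1's description of v5 follows.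

STATE OF THE LINE.  Everything provable-now has LANDED and is imported:
* `stub_cuspTransfer` — C⁺′ = `CuspLawD` ⇒ crux (`DeepModuli.stub_cuspTransfer`, seat …-2, file
  `…DeepModuliCuspTransfer.lean`; named form `CuspDispersion.transferD : TransferD`, `…CuspLawDTransfer.lean`, p98530);
* `stub_cuspStationaryPhase` — `|S(h₁,h₂;pⁿ)| ≤ 2p^{n/2}` for `p ≥ 5` (`DeepModuli.stub_cuspStationaryPhase`, seat …-2,
  `…DeepModuliStationaryPhase.lean`; named `CuspDispersion.cuspSumBound_holds : CuspSumBound`, `…CuspSumBoundNamed.lean`, p98423);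
* the line's objects and glue, NAMED: `…CuspDispersionDefs.lean` (p97075: `Nstar`, `cuspSetD`, `CuspLawD`, `simpleRad`,
  `LawOn`, `cuspSum`, `CuspSumBound`, typed regimes, `sharpModerateLaw_of_transfer_of_regimeLaws`) and
  `…CuspDispersionTwDefs.lean` (p98826: twist-aware regimes `HallRegimeTw`/`ThickTw`/`ResolvedRegimeTw`/`DeepRegimeTw`,
  `CuspSumBound23`, corrected cover `regimesTw_cover`, `sharpModerateLaw_of_transfer_of_regimeLawsTw`).

RESHAPE (v5), after the cycle-1 wave (evidence `stub-misstated-resolvedRegime.md`, `stub-blocked-hallRegime.md`,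
`work/deepRegime-analysis.md` of the lead):
(R1) the archimedean cut `|u³−v²| ≶ 1728√Y` of the typed regimes is NOT twist-covariant — the typed thick regimes contained
     the d-twists of HALL pairs of smaller scale (46–65 % of the typed resolved regime in the exact census Y = 2^27…2^41),
     which carry no dispersion modulus; the three regime stubs are re-typed over the twist-aware regimes (cut applied at
     every twist scale: `HallRegimeTw` ∋ twists of Hall-at-own-scale pairs; `ThickTw` = complement). The corrected thick
     stubs are WEAKER than the typed ones, the corrected Hall stub STRONGER (comparison lemmas in `…TwDefs.lean`); cover and
     composition re-proved there.
(R2) the dispersion modulus includes the 2,3-part of `u³ − v²` whenever `2,3 ∤ u` (61–68 % of the log-depth of twist-minimal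
     resolved pairs): the p ≥ 5 stationary phase does not touch it, so a NEW provable stub `stub_cuspStationaryPhase23`
     (`p ∈ {2,3}`, same bound `2p^{n/2}`; numerically max `|S|/p^{n/2}` = √2 resp. 1.88) is registered and threaded as a
     second hypothesis of the two dispersion stubs.
VERDICTS so far (with certificates): `stub_deepRegime` ≥ `MazurKaneLaw` (stmt-ABC-2757) via untwisted Frey pairs
(calibration `mazurKaneLaw_of_deepRegimeLaw`, typed regime; the Tw version differs only by the twist divisors d ∣ 4 of Frey
pairs); `stub_hallRegime` = `HallMissing` (Corner: strong-Hall near-misses ≪ U^ε ∧ Bulk: level of distribution Y^{1/6}+),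
and ⇒ square-root near-miss count (calibration `nearCuspSqrtCount_of_hallRegimeLaw`); `stub_resolvedRegime` =
`ResolvedMissing` (optimal per-modulus cusp-congruence count in the cusp-excised dyadic tube). All three open; the uniform gap on
the cone is a saving of exactly Y^{1/6} over divisor/lattice/FNT counting (statistical Szpiro at ratio 6 ∣ Mazur–Kane below 2 ∣
square-root cancellation for u^{3/2} mod 1, at the three edges).

THE SIX STUBS (v7: 3 landed, 3 open): `sorry` only inside `stub_*`; `SharpModerateLaw_of` concludes the crux BY
NAME over the kernel-checked glue of `…TwDefs.lean`; `SharpModerateLaw_closed` is the closed form (audit `proof-of-item`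
modulo the open stubs).  Disproof.lean v7j (no `-- Targets` section) honoured as in v2.1: `κ < 6` consumed in the transfer,
`N*` charges p² at additive primes (twist test), `c₄c₆ ≠ 0` / cusp excision / TF / dyadic floor in every set, `0 < ε` kept.
-/

set_option linter.dupNamespace false

namespace Summit.ABC.ABC.Cruxes.SharpModerateLaw.DeepModuliCuspDispersion

open Summit.ABC.ABC.Theorems.SharpModerateLaw.CuspDispersion

/-! ## The registered stubs -/

/-- **STUB 1 · `stub_cuspTransfer`** — LANDED (seat prover-line-stmt-ABC-1975-2, p96579): C⁺′ ⇒ crux. -/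
theorem stub_cuspTransfer :
    (∀ σ : ℝ, 6 < σ → ∀ ε : ℝ, 0 < ε → ∃ C : ℝ, ∀ X Y : ℝ, 1 ≤ X → 1 ≤ Y → X ^ 3 ≤ 8 * Y → Y ≤ X ^ σ →
      (Set.ncard {x : ℤ × ℤ | x.1 ≠ 0 ∧ x.2 ≠ 0 ∧ x.1 ^ 3 ≠ x.2 ^ 2 ∧ (1728 : ℤ) ∣ x.1 ^ 3 - x.2 ^ 2 ∧
          ((∀ p : ℕ, p.Prime → 5 ≤ p → ¬ ((p : ℤ) ^ 4 ∣ x.1 ∧ (p : ℤ) ^ 6 ∣ x.2)) ∧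
            ¬ ((2 : ℤ) ^ 8 ∣ x.1 ∧ (2 : ℤ) ^ 11 ∣ x.2) ∧ ¬ ((3 : ℤ) ^ 5 ∣ x.1 ∧ (3 : ℤ) ^ 9 ∣ x.2)) ∧
          ((|x.1| ^ 3 : ℤ) : ℝ) ≤ Y ∧ ((|x.1 ^ 3 - x.2 ^ 2| : ℤ) : ℝ) ≤ 1728 * Y ∧
          Y < 2 * max (((|x.1| ^ 3 : ℤ) : ℝ)) (((|x.1 ^ 3 - x.2 ^ 2| : ℤ) : ℝ) / 1728) ∧
          ((∏ p ∈ ((x.1 ^ 3 - x.2 ^ 2) / 1728).natAbs.primeFactors,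
              (if ((p : ℕ) : ℤ) ∣ x.1 then p ^ 2 else p) : ℕ) : ℝ) ≤ X} : ℝ) ≤
        C * X ^ ε * (X * Y ^ (-(1 / 6 : ℝ)) + 1)) →
      ∀ κ σ ε : ℝ, 3 < κ → κ < 6 → 6 < σ → 0 < ε → ∃ C : ℝ, ∀ X : ℝ, 1 ≤ X →
        (Set.ncard {W₀ : WeierstrassCurve ℤ | (W₀.baseChange ℚ).IsElliptic ∧
            (∀ v : IsDedekindDomain.HeightOneSpectrum ℤ, (W₀.baseChange ℚ).IsMinimalAt v) ∧
            (W₀.a₁ = 0 ∨ W₀.a₁ = 1) ∧ (W₀.a₃ = 0 ∨ W₀.a₃ = 1) ∧ (W₀.a₂ = -1 ∨ W₀.a₂ = 0 ∨ W₀.a₂ = 1) ∧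
            W₀.c₄ ≠ 0 ∧ W₀.c₆ ≠ 0 ∧ (((W₀.baseChange ℚ).conductorNorm ℤ : ℕ) : ℝ) ≤ X ∧
            (((W₀.baseChange ℚ).conductorNorm ℤ : ℕ) : ℝ) ^ κ ≤ ((max |W₀.Δ| (|W₀.c₄| ^ 3) : ℤ) : ℝ) ∧
            ((max |W₀.Δ| (|W₀.c₄| ^ 3) : ℤ) : ℝ) ≤ (((W₀.baseChange ℚ).conductorNorm ℤ : ℕ) : ℝ) ^ σ} : ℝ) ≤
          C * X ^ (1 - κ / 6 + ε) :=
  Summit.ABC.ABC.Theorems.SharpModerateLaw.DeepModuli.stub_cuspTransfer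

/-- **STUB 2 · `stub_cuspStationaryPhase`** — LANDED (seat prover-line-stmt-ABC-1975-2): `|S(h₁,h₂;pⁿ)| ≤ 2p^{n/2}`, `p ≥ 5`. -/
theorem stub_cuspStationaryPhase :
    ∀ p n : ℕ, p.Prime → 5 ≤ p → 2 ≤ n → ∀ h₁ h₂ : ℤ, ¬ ((p : ℤ) ∣ h₁ ∧ (p : ℤ) ∣ h₂) →
      ‖∑ t ∈ (Finset.range (p ^ n)).filter (fun t : ℕ => Nat.Coprime t p),
          Complex.exp (2 * (Real.pi : ℂ) * Complex.I * ((h₁ : ℂ) * (t : ℂ) ^ 2 + (h₂ : ℂ) * (t : ℂ) ^ 3) /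
            (p : ℂ) ^ n)‖ ≤ 2 * (p : ℝ) ^ ((n : ℝ) / 2) :=
  Summit.ABC.ABC.Theorems.SharpModerateLaw.DeepModuli.stub_cuspStationaryPhase

/-- **STUB 2′ · `stub_cuspStationaryPhase23`** — LANDED (lead c2's wave, p106637; `p = 3` half landed earlier as
`cuspSumBound23_three_main`): the stationary-phase bound `|S(h₁,h₂;pⁿ)| ≤ 2·p^{n/2}` at `p = 2, 3`, `n ≥ 2`,
`(h₁,h₂)` not both divisible by `p` (at `p = 2` no Gauss sum is needed: ≤ 2 critical odd classes; at `p = 3` one critical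
class and a quadratic Gauss sum mod 3). -/
theorem stub_cuspStationaryPhase23 :
    ∀ p n : ℕ, p.Prime → p < 5 → 2 ≤ n → ∀ h₁ h₂ : ℤ, ¬ ((p : ℤ) ∣ h₁ ∧ (p : ℤ) ∣ h₂) →
      ‖∑ t ∈ (Finset.range (p ^ n)).filter (fun t : ℕ => Nat.Coprime t p),
          Complex.exp (2 * (Real.pi : ℂ) * Complex.I * ((h₁ : ℂ) * (t : ℂ) ^ 2 + (h₂ : ℂ) * (t : ℂ) ^ 3) /
            (p : ℂ) ^ n)‖ ≤ 2 * (p : ℝ) ^ ((n : ℝ) / 2) :=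
  Summit.ABC.ABC.Theorems.SharpModerateLaw.CuspDispersion.stub_cuspStationaryPhase23

/-- **STUB 3 · `stub_resolvedRegime`** (RESHAPED v5; XL; OPEN — `stub-blocked: none — ResolvedMissing`; the reduction
`lawOn_resolvedRegimeTw_of_missing : ResolvedMissingTw → LawOn ResolvedRegimeTw` is LANDED (v7), so this stub = `ResolvedMissingTw`): both stationary-phase
inputs ⇒ the law on the TWIST-AWARE resolved regime `ResolvedRegimeTw` (`ThickTw ∧ r' ≥ Y^{1/6}`; `…TwDefs.lean`). Content
(worker W3's analysis, evidence `stub-misstated-resolvedRegime.md`): an OPTIMAL per-modulus (or class-averaged) count of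
cusp-congruence points `(u,v) ≡ (t²,t³) mod e` in the cusp-excised dyadic tube, `ResolvedMissing`: ∀ε ∃C ∀e,a ≥ 1 ∀Y ≥ 1
∀L ∈ [√Y, Y], e ≤ 1728·L·Y^{-1/6}: #{(u,v) ∈ tube(Y,L) : (u,e)=1, e ∣ u³−v², a ∣ u, a ∣ v} ≤ C·Y^ε·(L·Y^{-1/6}/(e·a²) + 1);
dual form = square-root cancellation in BOTH dual variables of `Σ I(h) S(h₁,h₂;e)` with u-length `Y^{1/3} ∈ [e^{2/5}, 4e²]`;
completion + CRT + `CuspSumBound(23)` close NO non-empty sub-range (loss ≥ Y^{1/6}/(4a) on every class); only `X < Y^{1/6}`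
closes (set empty, `r' ≤ N* ≤ X`). -/
theorem stub_resolvedRegime : CuspSumBound → CuspSumBound23 → LawOn ResolvedRegimeTw := by
  sorry

/-- **STUB 4 · `stub_deepRegime`** (RESHAPED v5; the LOAD-BEARING and HARDEST stub; XL; OPEN; v7: its conclusion ALONE implies the
summit — `abc_of_lawOn_deepRegimeTw : LawOn DeepRegimeTw → ABC`, landed this cycle — as well as `MazurKaneLaw`): both stationary-phase inputs ⇒
the law on the TWIST-AWARE deep regime `DeepRegimeTw` (`ThickTw ∧ r' < Y^{1/6}`). 71–86 % of C⁺′ in the census; level of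
distribution 6/5 for the cusp congruence over `{e powerful, rad e ≤ Q}`; ≥ `MazurKaneLaw` (stmt-ABC-2757): the untwisted Frey
pairs `(16(a²+ab+b²), −32(b−a)(2a+b)(a+2b))` of abc triples have `r' = 1`, `N* = 2·rad(abc)`, `|Δ| = 16(abc)² > √Y·d³` for
their only twist divisors `d ∣ 4` once `c` is large — calibration `mazurKaneLaw_of_deepRegimeLaw` (typed regime) + the Tw
variant. Q1 (dual diagonal after excision): the diagonal `27h₂² ∣ 4h₁³` is the Fourier image of the RATIONAL cusp points
(s², s³), exactly e-independent; a proof must count the neighbourhoods of small-denominator rational cusp points physically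
(the Hall lever `u = w² + k′`) and apply Poisson + stationary phase + reciprocity only to the complement
(`work/deepRegime-analysis.md` of the lead). -/
theorem stub_deepRegime : CuspSumBound → CuspSumBound23 → LawOn DeepRegimeTw := by
  sorry

/-- **STUB 5 · `stub_hallRegime`** (RESHAPED v5; XL; OPEN — `stub-blocked: none — HallMissing`): the law on the TWIST-AWARE
Hall regime `HallRegimeTw` (pairs whose twist-minimal reduction lies in the Hall tube of its own scale; contains the typed
`HallRegime`, so this stub is STRONGER than v2.1's and every certificate from `LawOn HallRegime` transfers:
`lawOn_hallRegime_of_lawOn_hallRegimeTw`). Content (worker W4, evidence `stub-blocked-hallRegime.md`): `HallMissing =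
Corner (#{u ∼ U : 0 < |u³−v²| ≤ 1728√u, N* ≤ √U} ≪ U^ε — counting strong-Hall near-misses at the critical exponent) ∧ Bulk
(level of distribution Y^{1/6}+ of the near-cusp values D_k(u) = u³ − (⌊u^{3/2}⌉+k)² modulo powerful moduli)`; top edge alone
= an (ε, ½+ε) exponent pair for u^{3/2} (Bourgain: U^0.73 vs U^0.5); exact enumeration of the whole regime to Y = 2^72 vs a
random-Δ control: no structure beyond the Robert–Tenenbaum radical-multiplicity factor; a certified violating family ⟺ ¬abc.
Certificate: `nearCuspSqrtCount_of_hallRegimeLaw` (Hall law ⇒ #{2|u³−v²| ≤ √u, u ≤ U sqfree ⊥ 6} ≤ C U^{1/2+ε}). -/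
theorem stub_hallRegime : LawOn HallRegimeTw := by
  sorry

/-! ## Named ingredients from the landed stubs -/

/-- `CuspSumBound23` from the landed STUB 2′ (definitional unfolding of `cuspSum`). -/
theorem cuspSumBound23_of_stub : CuspSumBound23 := stub_cuspStationaryPhase23

/-! ### Name-keyed aliases of the three OPEN statements (hypotheses of the composition; STUBS 1, 2, 2′ are landed
theorems and enter the composition as the tree terms `transferD`, `cuspSumBound_holds`, `cuspSumBound23_of_stub`) -/
namespace Registered

/-- Alias keyed by the registered stub name. -/
abbrev stub_resolvedRegime : Prop := ResolvedRegimeLawTw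
/-- Alias keyed by the registered stub name. -/
abbrev stub_deepRegime : Prop := DeepRegimeLawTw
/-- Alias keyed by the registered stub name. -/
abbrev stub_hallRegime : Prop := HallRegimeLawTw

end Registered

/-! ## The composition: the three open stubs imply the crux, BY NAME -/

/-- **`SharpModerateLaw_of`** — glue of the line (pure logic over the kernel-checked corrected cover of `…TwDefs.lean`):
the LANDED stubs 1, 2, 2′ (`transferD`, `cuspSumBound_holds`, `cuspSumBound23_of_stub`) feed STUBS 3–4, which with STUB 5
give C⁺′ on the three twist-aware regimes, which cover; the landed transfer concludes the crux. Hypotheses = exactly the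
three open registered stubs (v7). -/
theorem SharpModerateLaw_of (h3 : Registered.stub_resolvedRegime) (h4 : Registered.stub_deepRegime)
    (h5 : Registered.stub_hallRegime) : Summit.ABC.ABC.Theses.TwistAmplification.SharpModerateLaw :=
  sharpModerateLaw_of_transfer_of_regimeLawsTw transferD (h3 cuspSumBound_holds cuspSumBound23_of_stub)
    (h4 cuspSumBound_holds cuspSumBound23_of_stub) h5

/-- **`SharpModerateLaw_closed`** — the same composition as a CLOSED term over the registered stubs (audit class
`proof-of-item` modulo the open `stub_*`): when STUBS 3, 4, 5 land, this is the sorry-free proof to propose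
`--workitem stmt-ABC-1975`. -/
theorem SharpModerateLaw_closed : Summit.ABC.ABC.Theses.TwistAmplification.SharpModerateLaw :=
  SharpModerateLaw_of stub_resolvedRegime stub_deepRegime stub_hallRegime

end Summit.ABC.ABC.Cruxes.SharpModerateLaw.DeepModuliCuspDispersion
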